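import Summits.CriticalPhenomena.SAWScalingLimit.Theorems.SAWLeftRightFKGFKGToTraversalBoundGatesDefs
import Summits.CriticalPhenomena.SAWScalingLimit.Theorems.SAWLeftRightFKGFKGToTraversalBoundKilledWalkCollarPassage
import Literature.Probability.RandomPlanarGeometry.SAWTargetOrder
import HarnessLib

/-!
# Crosscuts and sliding windows for collar structures (helper of stub `stub_collarAssembly`)

Crux `SAWLeftRightFKG.FKGToTraversalBound` (stmt-CriticalPhenomena-1878), line `gates-by-bubble-doors-by-fkg`,
registered helper `stub_collarWindow` of STUB 4 (`stub_collarAssembly`, the access trichotomy).  The two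
def-free combinatorial reductions by which the assembly feeds a given collar structure `(V, H)` to the wide-door
seed / the gate lemma at OTHER radii and with OTHER far sets:

* CROSSCUT MONOTONICITY (`avoid_subset_avoid_of_cut`, `cut_by_collar`): a chord visiting `h ∈ H` has a prefix
  `a → h`, so if every lattice walk from `a` to `H` inside `Λ` meets `S` then `Avoid S ⊆ Avoid H`; in particular
  `Avoid V ⊆ Avoid H` for a collar structure (`H` misses the sites joined to `a` off `V`).
* SLIDING WINDOW (`stub_collarWindow`, second orientation of `CollarClauses`: `Near` beyond `R`, `H`-side inside
  `r`): with `U := Λ ∖ Near` (the culs-de-sac of the structure), for every window `r + 2δ ≤ r'`, `r' + δ ≤ R' ≤ R`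
  the pair `V' := U ∩ {r' ≤ |δx − z₀| ≤ R'}`, `S := U ∩ {r' − δ ≤ |δx − z₀| < r'}` is AGAIN a collar structure of
  the second orientation at radii `(r', R')`, and `S` cuts `H` from `a` inside `Λ`.  Hence
  `Z(Avoid H) ≥ Z(Avoid S)` and the seed / gates may be applied to `(V', S)` in any window of modulus `R'/r'`
  inside `[r, R]` — narrow doors of `H` sitting on the rim of `V` (the "many short throats" configuration) are
  never looked at.  Proof: two closure properties along lattice steps off `V'` resp. off `S`
  (`Near ∪ (U ∩ {> R'})` and `HJoined ∪ (U ∩ {< r' − δ})` are stable), run along walks (`walk_closed`).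
* DICHOTOMY (`wide_or_cut`): a collar structure is wide at width `w₀` or some `w₀`-box touching `V` and missing
  `a, b` cuts a site of `H` from `a` inside `Λ` (unfolding).

Only theorems; no named fact; axioms are the standard three.
-/

noncomputable section

open Set Metric SimpleGraph
open Literature.Probability.LatticeModels
open Literature.Probability.RandomPlanarGeometry
open Literature.Probability.RandomPlanarGeometry.SAW
open Summit.CriticalPhenomena.SAWScalingLimit.Theorems.FKGToTraversalBound.ExcursionDomination.KilledWalkCollar
  (abs_dist_sub_dist_le_of_adj joined_refl joined_trans mem_of_joined_left mem_of_joined_right joined_of_adj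
    joined_of_mem_support mem_collar_of_adj_near)

namespace Summit.CriticalPhenomena.SAWScalingLimit.Theorems.FKGToTraversalBound.GatesByBubbleDoorsByFKG

/-! ### Walks: a predicate stable under admissible steps holds at the end -/

/-- **Closure along a walk.**  If `P` is preserved by every lattice step into a site satisfying `Q`, then along a
lattice walk all of whose sites satisfy `Q`, `P` propagates from the start to the end. [folklore] -/
theorem walk_closed {P Q : Site 2 → Prop} (hstep : ∀ x y, P x → (zdGraph 2).Adj x y → Q y → P y)
    {u v : Site 2} (p : (zdGraph 2).Walk u v) (hp : ∀ x ∈ p.support, Q x) (hu : P u) : P v := by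
  induction p with
  | nil => exact hu
  | @cons x y z h q ih =>
    have hy : Q y := hp y (by rw [Walk.support_cons]; exact List.mem_cons_of_mem _ q.start_mem_support)
    exact ih (fun w hw => hp w (by rw [Walk.support_cons]; exact List.mem_cons_of_mem _ hw)) (hstep x y hu h hy)

/-! ### Crosscut monotonicity of avoidance events -/

section Crosscut

variable {Ω : Set ℂ} {δ : ℝ} {a b : Site 2}

/-- **Crosscut monotonicity.**  If every `Ω_δ`-walk from `a` to a site of `H` meets `S`, then a chord avoiding `S`
avoids `H`: `Avoid S ⊆ Avoid H`. [folklore] -/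
theorem avoid_subset_avoid_of_cut {H S : Set (Site 2)}
    (hcut : ∀ h ∈ H, ∀ p : (discreteDomainGraph Ω δ).Walk a h, ∃ x ∈ p.support, x ∈ S) :
    (Avoid S : Set (DomainSAW Ω δ a b)) ⊆ Avoid H := by
  classical
  intro γ hγ v hv hvH
  obtain ⟨x, hx, hxS⟩ := hcut v hvH (γ.walk.takeUntil v hv)
  exact hγ x (γ.walk.support_takeUntil_subset_support hv hx) hxS

/-- All sites of an `Ω_δ`-walk from a site of `Λ ⊇ Ω_δ` lie in `Λ`. [folklore] -/
theorem support_subset_of_start_mem {Λ : Finset (Site 2)} (hΛ : ∀ x, x ∈ meshDomain Ω δ → x ∈ Λ)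
    {u v : Site 2} (p : (discreteDomainGraph Ω δ).Walk u v) (hu : u ∈ Λ) : ∀ x ∈ p.support, x ∈ Λ := by
  induction p with
  | nil => intro x hx; rw [Walk.support_nil, List.mem_singleton] at hx; rw [hx]; exact hu
  | @cons x y z h q ih =>
    intro w hw
    rw [Walk.support_cons, List.mem_cons] at hw
    rcases hw with rfl | hw
    · exact hu
    · exact ih (hΛ y (discreteDomainGraph_adj_iff.1 h).2.2) w hw

/-- **Crosscut monotonicity, lattice form.**  If `Λ ⊇ Ω_δ` contains `a` and every `ℤ²`-walk from `a` to a site of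
`H` inside `Λ` meets `S`, then `Avoid S ⊆ Avoid H` for the chords of `Ω_δ` from `a`. [folklore] -/
theorem avoid_subset_avoid_of_latticeCut {Λ : Finset (Site 2)} {H S : Set (Site 2)}
    (hΛ : ∀ x, x ∈ meshDomain Ω δ → x ∈ Λ) (ha : a ∈ Λ)
    (hcut : ∀ h ∈ H, ∀ q : (zdGraph 2).Walk a h, (∀ x ∈ q.support, x ∈ Λ) → ∃ x ∈ q.support, x ∈ S) :
    (Avoid S : Set (DomainSAW Ω δ a b)) ⊆ Avoid H := by
  refine avoid_subset_avoid_of_cut fun h hh p => ?_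
  have hsupp : (p.map (Hom.ofLE (discreteDomainGraph_le_zdGraph Ω δ))).support = p.support := by
    rw [Walk.support_map, Hom.coe_ofLE, List.map_id]
  obtain ⟨x, hx, hxS⟩ := hcut h hh (p.map (Hom.ofLE (discreteDomainGraph_le_zdGraph Ω δ)))
    (fun x hx => support_subset_of_start_mem hΛ p ha x (hsupp ▸ hx))
  exact ⟨x, hsupp ▸ hx, hxS⟩

end Crosscut

/-! ### Collar structures: the collar cuts the far set; sliding windows -/

section Collar

variable {Λ V H : Finset (Site 2)} {a b : Site 2} {δ : ℝ} {z₀ : ℂ} {r R : ℝ}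

/-- `JoinedOff` unfolded. [folklore] -/
theorem joinedOff_iff {Λ V : Finset (Site 2)} {u v : Site 2} :
    JoinedOff Λ V u v ↔ ∃ p : (zdGraph 2).Walk u v, ∀ x ∈ p.support, x ∈ Λ ∧ x ∉ V := Iff.rfl

/-- **The collar cuts the far set from `a`.**  In a collar structure every lattice walk from `a` to a site of `H`
inside `Λ` meets `V` (else its end would be joined to `a` off `V`, which `H` misses); hence `Avoid V ⊆ Avoid H`
(`avoid_subset_avoid_of_latticeCut`). [folklore] -/
theorem cut_by_collar (hC : CollarClauses Λ a b δ z₀ r R H V) {h : Site 2} (hh : h ∈ H)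
    (q : (zdGraph 2).Walk a h) (hq : ∀ x ∈ q.support, x ∈ Λ) : ∃ x ∈ q.support, x ∈ V := by
  by_contra hno
  push Not at hno
  exact hC.2.2.2.1 h ⟨q, fun x hx => ⟨hq x hx, hno x hx⟩⟩ hh

/-- **SLIDING WINDOW** (registered helper `stub_collarWindow` of STUB 4 `stub_collarAssembly`, crux
stmt-CriticalPhenomena-1878).  Let `(V, H)` satisfy the collar clauses at radii `(r, R)` about `z₀` in the SECOND
orientation (sites joined to `a` off `V` touch `V` only beyond `R`; sites joined to `H` off `V` touch `V` only
inside `r`), and let `U := {x ∈ Λ | x not joined to a off V}`.  For every window `r + 2δ ≤ r'`, `r' + δ ≤ R' ≤ R`,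
the sets `V' := U ∩ {r' ≤ |δx − z₀| ≤ R'}` and `S := U ∩ {r' − δ ≤ |δx − z₀| < r'}` satisfy: `(V', S)` fulfils the
collar clauses at radii `(r', R')` about `z₀`, again in the second orientation, and `S` CUTS `H` from `a` inside
`Λ` (so `Avoid S ⊆ Avoid H` by `avoid_subset_avoid_of_latticeCut`).  Proof: `Near ∪ (U ∩ {> R'})` is stable under
lattice steps inside `Λ` off `V'`, and `HJoined ∪ (U ∩ {< r' − δ})` is stable under steps inside `Λ` off `S`
(one lattice step moves `|δx − z₀|` by `≤ δ`). -/
theorem stub_collarWindow : ∀ (Λ : Finset (Site 2)) (a b : Site 2) (δ : ℝ) (z₀ : ℂ) (r R r' R' : ℝ) (H V : Finset (Site 2)), 0 < δ → CollarClauses Λ a b δ z₀ r R H V → (∀ x ∈ V, ∀ y ∈ Λ, y ∉ V → (zdGraph 2).Adj x y → (JoinedOff Λ V a y → R < dist (meshPoint δ y) z₀) ∧ ((∃ h ∈ H, JoinedOff Λ V y h) → dist (meshPoint δ y) z₀ < r)) → r + 2 * δ ≤ r' → r' + δ ≤ R' → R' ≤ R → ∃ V' S : Finset (Site 2), (∀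 x, x ∈ V' ↔ x ∈ Λ ∧ ¬ JoinedOff Λ V a x ∧ r' ≤ dist (meshPoint δ x) z₀ ∧ dist (meshPoint δ x) z₀ ≤ R') ∧ (∀ x, x ∈ S ↔ x ∈ Λ ∧ ¬ JoinedOff Λ V a x ∧ r' - δ ≤ dist (meshPoint δ x) z₀ ∧ dist (meshPoint δ x) z₀ < r') ∧ CollarClauses Λ a b δ z₀ r' R' S V' ∧ (∀ x ∈ V', ∀ y ∈ Λ, y ∉ V' → (zdGraph 2).Adj x y → (JoinedOff Λ V' a y → R' < dist (meshPoint δ y) z₀) ∧ ((∃ h ∈ S, JoinedOff Λ V' y h) → dist (meshPoint δ y) z₀ < r')) ∧ (∀ h ∈ H, ∀ q : (zdGraph 2).Walk a h, (∀ x ∈ q.support, x ∈ Λ) → ∃ x ∈ q.support, x ∈ S) := by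
  classical
  intro Λ a b δ z₀ r R r' R' H V hδ hC hB h1 h2 h3
  obtain ⟨hVΛ, -, hab, hHnear, hHV, hbdry, -⟩ := hC
  -- abbreviations
  set d : Site 2 → ℝ := fun x => dist (meshPoint δ x) z₀ with hd
  set Near : Site 2 → Prop := fun y => JoinedOff Λ V a y with hNear
  set V' : Finset (Site 2) := Λ.filter fun x => ¬ Near x ∧ r' ≤ d x ∧ d x ≤ R' with hV'
  set S : Finset (Site 2) := Λ.filter fun x => ¬ Near x ∧ r' - δ ≤ d x ∧ d x < r' with hS
  have memV' : ∀ x, x ∈ V' ↔ x ∈ Λ ∧ ¬ Near x ∧ r' ≤ d x ∧ d x ≤ R' := fun x => by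
    rw [hV', Finset.mem_filter]
  have memS : ∀ x, x ∈ S ↔ x ∈ Λ ∧ ¬ Near x ∧ r' - δ ≤ d x ∧ d x < r' := fun x => by
    rw [hS, Finset.mem_filter]
  -- basic facts
  have hstep : ∀ {x y : Site 2}, (zdGraph 2).Adj x y → |d y - d x| ≤ δ :=
    fun h => abs_dist_sub_dist_le_of_adj hδ z₀ h
  have hNa : Near a := by
    obtain ⟨p, hp⟩ := hab
    exact joined_refl (hp a p.start_mem_support)
  have hVU : ∀ x ∈ V, ¬ Near x := fun x hx hN => (mem_of_joined_right hN).2 hx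
  -- a Near site adjacent to a collar site lies beyond `R`
  have hfar : ∀ {v n : Site 2}, v ∈ V → (zdGraph 2).Adj v n → Near n → R < d n := by
    intro v n hv hadj hN
    exact (hB v hv n (mem_of_joined_right hN).1 (mem_of_joined_right hN).2 hadj).1 hN
  -- a `Λ`-site off `Near` adjacent to a Near site is a collar site
  have hcol : ∀ {x y : Site 2}, x ∈ Λ → ¬ Near x → (zdGraph 2).Adj x y → Near y → x ∈ V :=
    fun hx hNx hadj hNy => mem_collar_of_adj_near hx hNx hadj hNy
  -- closure 1: `W := Near ∪ (U ∩ {> R'})` is stable under steps inside `Λ` off `V'`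
  set W : Site 2 → Prop := fun y => Near y ∨ (y ∈ Λ ∧ ¬ Near y ∧ R' < d y) with hW
  have hWstep : ∀ x y, W x → (zdGraph 2).Adj x y → (y ∈ Λ ∧ y ∉ V') → W y := by
    rintro x y hx hadj ⟨hyΛ, hyV'⟩
    by_cases hNy : Near y
    · exact Or.inl hNy
    · right
      refine ⟨hyΛ, hNy, ?_⟩
      have hlow : r' ≤ d y := by
        rcases hx with hNx | ⟨-, -, hRx⟩
        · have hyV : y ∈ V := hcol hyΛ hNy hadj.symm hNx
          have := hfar hyV hadj.symm hNx
          have hs := hstep hadj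
          rw [abs_le] at hs
          linarith [hs.1]
        · have hs := hstep hadj
          rw [abs_le] at hs
          linarith [hs.1]
      by_contra hle
      push Not at hle
      exact hyV' ((memV' y).2 ⟨hyΛ, hNy, hlow, hle⟩)
  have hWwalk : ∀ {u v : Site 2} (p : (zdGraph 2).Walk u v), (∀ x ∈ p.support, x ∈ Λ ∧ x ∉ V') →
      W u → W v := fun p hp hu => walk_closed hWstep p hp hu
  have hWnotS : ∀ {y : Site 2}, W y → y ∉ S := by
    intro y hy hyS
    obtain ⟨-, hNy, -, hlt⟩ := (memS y).1 hyS
    rcases hy with hN | ⟨-, -, hgt⟩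
    · exact hNy hN
    · linarith
  -- closure 2: `W₂ := HJoined ∪ (U ∩ {< r' - δ})` is stable under steps inside `Λ` off `S`
  set HJ : Site 2 → Prop := fun y => ∃ h ∈ H, JoinedOff Λ V y h with hHJ
  set W₂ : Site 2 → Prop := fun y => HJ y ∨ (y ∈ Λ ∧ ¬ Near y ∧ d y < r' - δ) with hW₂
  have hW₂step : ∀ x y, W₂ x → (zdGraph 2).Adj x y → (y ∈ Λ ∧ y ∉ S) → W₂ y := by
    rintro x y hx hadj ⟨hyΛ, hyS⟩
    rcases hx with ⟨h, hh, hxh⟩ | ⟨hxΛ, hNx, hdx⟩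
    · by_cases hyV : y ∈ V
      · right
        have hx' := mem_of_joined_left hxh
        have hlt : d x < r := (hB y hyV x hx'.1 hx'.2 hadj.symm).2 ⟨h, hh, hxh⟩
        have hs := hstep hadj
        rw [abs_le] at hs
        exact ⟨hyΛ, hVU y hyV, by linarith [hs.2]⟩
      · exact Or.inl ⟨h, hh, joined_trans (joined_of_adj ⟨hyΛ, hyV⟩ (mem_of_joined_left hxh) hadj.symm) hxh⟩
    · right
      have hs := hstep hadj
      rw [abs_le] at hs
      have hdy : d y < r' := by linarith [hs.2]
      have hNy : ¬ Near y := by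
        intro hNy
        have hxV : x ∈ V := hcol hxΛ hNx hadj hNy
        have := hfar hxV hadj hNy
        linarith
      refine ⟨hyΛ, hNy, ?_⟩
      by_contra hge
      push Not at hge
      exact hyS ((memS y).2 ⟨hyΛ, hNy, hge, hdy⟩)
  -- the cut property
  have hcut : ∀ h ∈ H, ∀ q : (zdGraph 2).Walk a h, (∀ x ∈ q.support, x ∈ Λ) → ∃ x ∈ q.support, x ∈ S := by
    intro h hh q hq
    by_contra hno
    push Not at hno
    have hhΛ : h ∈ Λ := hq h q.end_mem_support
    have hhV : h ∉ V := fun hv => hHV h hv hh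
    have hstart : W₂ h := Or.inl ⟨h, hh, joined_refl ⟨hhΛ, hhV⟩⟩
    have hend : W₂ a := walk_closed hW₂step q.reverse (fun x hx => by
      rw [Walk.support_reverse, List.mem_reverse] at hx
      exact ⟨hq x hx, hno x hx⟩) hstart
    rcases hend with ⟨h', hh', hah'⟩ | ⟨-, hNa', -⟩
    · exact hHnear h' hah' hh'
    · exact hNa' hNa
  -- the orientation clause of the window structure
  have hB' : ∀ x ∈ V', ∀ y ∈ Λ, y ∉ V' → (zdGraph 2).Adj x y →
      (JoinedOff Λ V' a y → R' < d y) ∧ ((∃ h ∈ S, JoinedOff Λ V' y h) → d y < r') := by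
    intro x hx y hyΛ hyV' hadj
    obtain ⟨hxΛ, hNx, -, -⟩ := (memV' x).1 hx
    constructor
    · intro hay
      obtain ⟨p, hp⟩ := hay
      rcases hWwalk p hp (Or.inl hNa) with hNy | ⟨-, -, hgt⟩
      · exact lt_of_le_of_lt h3 (hfar (hcol hxΛ hNx hadj hNy) hadj hNy)
      · exact hgt
    · rintro ⟨s, hs, ⟨p, hp⟩⟩
      by_contra hge
      push Not at hge
      have hWy : W y := by
        by_cases hNy : Near y
        · exact Or.inl hNy
        · refine Or.inr ⟨hyΛ, hNy, ?_⟩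
          by_contra hle
          push Not at hle
          exact hyV' ((memV' y).2 ⟨hyΛ, hNy, hge, hle⟩)
      exact hWnotS (hWwalk p hp hWy) hs
  refine ⟨V', S, memV', memS, ⟨Finset.filter_subset _ _, ?_, ?_, ?_, ?_, ?_, Or.inr hB'⟩, hB', hcut⟩
  · intro x hx
    obtain ⟨-, -, h₁, h₂⟩ := (memV' x).1 hx
    exact ⟨h₁, h₂⟩
  · obtain ⟨p, hp⟩ := hab
    refine ⟨p, fun x hx => ⟨(hp x hx).1, fun hxV' => ?_⟩⟩
    exact ((memV' x).1 hxV').2.1 (joined_of_mem_support p hp hx)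
  · rintro y ⟨p, hp⟩
    exact hWnotS (hWwalk p hp (Or.inl hNa))
  · intro x hx hxS
    obtain ⟨-, -, h₁, -⟩ := (memV' x).1 hx
    obtain ⟨-, -, -, h₂⟩ := (memS x).1 hxS
    linarith
  · obtain ⟨p, hpΛ, hpd⟩ := hbdry
    exact ⟨p, hpΛ, by linarith⟩

end Collar

/-! ### Wide or cut -/

/-- **Dichotomy.**  A collar structure is WIDE at lattice width `w₀`, or else — for the collar set `V` of the
structure — some lattice box of side `w₀` missing `a` and `b` and touching `V` cuts some site of `H` from `a`
inside `Λ` (every `ℤ²`-walk from `a` to it inside `Λ` enters the box).  Pure unfolding of `WideCollaredOff`.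
[folklore] -/
theorem wide_or_cut {Λ : Finset (Site 2)} {a b : Site 2} {δ : ℝ} {z₀ : ℂ} {r R : ℝ} {H : Finset (Site 2)}
    (w₀ : ℕ) (h : IsCollaredOff Λ a b δ z₀ r R H) :
    WideCollaredOff Λ a b δ z₀ r R H w₀ ∨
      ∃ (V : Finset (Site 2)) (q h : Site 2), CollarClauses Λ a b δ z₀ r R H V ∧ ¬ InBox q w₀ a ∧
        ¬ InBox q w₀ b ∧ (∃ v ∈ V, InBox q w₀ v) ∧ h ∈ H ∧
        ∀ p : (zdGraph 2).Walk a h, (∀ x ∈ p.support, x ∈ Λ) → ∃ x ∈ p.support, InBox q w₀ x := by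
  obtain ⟨V, hV⟩ := h
  by_cases hw : ∀ q : Site 2, ¬ InBox q w₀ a → ¬ InBox q w₀ b → (∃ v ∈ V, InBox q w₀ v) →
      ∀ h ∈ H, ∃ p : (zdGraph 2).Walk a h, ∀ x ∈ p.support, x ∈ Λ ∧ ¬ InBox q w₀ x
  · exact Or.inl ⟨V, hV, hw⟩
  · right
    push Not at hw
    obtain ⟨q, hqa, hqb, hqV, h, hh, hcut⟩ := hw
    refine ⟨V, q, h, hV, hqa, hqb, hqV, hh, fun p hp => ?_⟩
    obtain ⟨x, hx, hbox⟩ := hcut p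
    exact ⟨x, hx, hbox (hp x hx)⟩

end Summit.CriticalPhenomena.SAWScalingLimit.Theorems.FKGToTraversalBound.GatesByBubbleDoorsByFKG

end
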